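import Mathlib
import Summits.ValiantsHypothesis.ValiantsHypothesis.Theorems.BarrierLeverPartitionMinorsHitByVPHiddenStatesSecondShellMasterTemplate
import Summits.ValiantsHypothesis.ValiantsHypothesis.Theorems.BarrierLeverPartitionMinorsHitByVPHiddenStatesSecondShellNestedRows
import Summits.ValiantsHypothesis.ValiantsHypothesis.Theorems.BarrierLeverPartitionMinorsHitByVPHiddenStatesSecondShellPrescribed

/-!
# Route BarrierLever — item `PartitionMinorsHitByVP` (stmt-ValiantsHypothesis-19717), line `hidden-states`:
# NEIGHBOURHOODS IN A TRANSPORTED PATH TABLE — sources and targets of every edge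

Helper file (`--supports stmt-ValiantsHypothesis-19717`; cell valiant-natproofs, 𝒟-side door (c), registered line
`Cruxes/PartitionMinorsHitByVP/Lines/hidden_states.lean` v9; prover seat val-np-p6 gen 20).  Closes NO item; definition-free.

The toolkit the ∀t second-shell cells need about the support digraph of `swapTable' e` (transport `e` of the swap `A → C`:
Y-path `C ∖ A`, attachments `A ∖ C`, inert blocks `A ∩ C`, `(A ∪ C)ᶜ`; memo HOME/val-np-p6/g20/MEMO-valnp6-g20.md §4):
* `exists_pos_of_mem_Y`, `exists_idx_of_mem_X` — every element of `C ∖ A` / `A ∖ C` is a path node / an attachment of `e`;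
* `swapTable'_target` — an edge `a → q` has `a ∈ C ∖ A` and `q ∈ (C ∖ A) ∪ (A ∖ C)`;
* `swapTable'_source_of_path` — the only source of the path node at position `p` is the node at position `p + 1`;
* `swapTable'_source_of_att` — the only source of the attachment `i` is the node at position `lvlX k i`;
* `swapTable'_col_zero` — coordinates outside `(C ∖ A) ∪ (A ∖ C)` are nobody's target.

HONEST LABEL: conjecture-column toolkit (second shell, every `t, h`); 19717 stays OPEN; nothing on crux 14610 or VP ≠ VNP.
-/

set_option linter.dupNamespace false

namespace Summit.ValiantsHypothesis.ValiantsHypothesis.Theorems.BarrierLever.HiddenStates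

open Finset

noncomputable section

namespace SecondShell

open PathTable

variable {α : Type} [Fintype α] [DecidableEq α]

/-- every Y-element is a path node of the transport. -/
theorem exists_pos_of_mem_Y {k j j' : ℕ} {A C : Finset α} (e : (Fin (k + 1) ⊕ Fin k) ⊕ (Fin j ⊕ Fin j') ≃ α)
    (m2 : ∀ i, e (Sum.inl (Sum.inr i)) ∈ A \ C) (m3 : ∀ z, e (Sum.inr (Sum.inl z)) ∈ A ∩ C)
    (m4 : ∀ w, e (Sum.inr (Sum.inr w)) ∈ (A ∪ C)ᶜ) {a : α} (ha : a ∈ C \ A) :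
    ∃ p : Fin (k + 1), e (Sum.inl (Sum.inl p)) = a := by
  rcases hex : e.symm a with (p | i) | (z | w')
  · exact ⟨p, by rw [← hex, Equiv.apply_symm_apply]⟩
  · exfalso; have := m2 i; rw [← hex, Equiv.apply_symm_apply] at this
    rw [Finset.mem_sdiff] at ha this; exact this.2 ha.1
  · exfalso; have := m3 z; rw [← hex, Equiv.apply_symm_apply] at this
    rw [Finset.mem_sdiff] at ha; rw [Finset.mem_inter] at this; exact ha.2 this.1
  · exfalso; have := m4 w'; rw [← hex, Equiv.apply_symm_apply] at this
    rw [Finset.mem_sdiff] at ha; rw [Finset.mem_compl, Finset.mem_union] at this; exact this (Or.inr ha.1)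

/-- every X-element is an attachment of the transport. -/
theorem exists_idx_of_mem_X {k j j' : ℕ} {A C : Finset α} (e : (Fin (k + 1) ⊕ Fin k) ⊕ (Fin j ⊕ Fin j') ≃ α)
    (m1 : ∀ b, e (Sum.inl (Sum.inl b)) ∈ C \ A) (m3 : ∀ z, e (Sum.inr (Sum.inl z)) ∈ A ∩ C)
    (m4 : ∀ w, e (Sum.inr (Sum.inr w)) ∈ (A ∪ C)ᶜ) {x : α} (hx : x ∈ A \ C) :
    ∃ i : Fin k, e (Sum.inl (Sum.inr i)) = x := by
  rcases hex : e.symm x with (p | i) | (z | w')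
  · exfalso; have := m1 p; rw [← hex, Equiv.apply_symm_apply] at this
    rw [Finset.mem_sdiff] at hx this; exact this.2 hx.1
  · exact ⟨i, by rw [← hex, Equiv.apply_symm_apply]⟩
  · exfalso; have := m3 z; rw [← hex, Equiv.apply_symm_apply] at this
    rw [Finset.mem_sdiff] at hx; rw [Finset.mem_inter] at this; exact hx.2 this.2
  · exfalso; have := m4 w'; rw [← hex, Equiv.apply_symm_apply] at this
    rw [Finset.mem_sdiff] at hx; rw [Finset.mem_compl, Finset.mem_union] at this; exact this (Or.inl hx.1)

/-- **targets of edges**: a nonzero off-diagonal entry `swapTable' e a q` has `a` on the path and `q` on the path or among the attachments. -/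
theorem swapTable'_target {k j j' : ℕ} (A C : Finset α) (e : (Fin (k + 1) ⊕ Fin k) ⊕ (Fin j ⊕ Fin j') ≃ α)
    (m1 : ∀ b, e (Sum.inl (Sum.inl b)) ∈ C \ A) (m2 : ∀ i, e (Sum.inl (Sum.inr i)) ∈ A \ C)
    (m3 : ∀ z, e (Sum.inr (Sum.inl z)) ∈ A ∩ C) (m4 : ∀ w, e (Sum.inr (Sum.inr w)) ∈ (A ∪ C)ᶜ)
    {a q : α} (h : swapTable' e a q ≠ 0) (hne : q ≠ a) : a ∈ C \ A ∧ (q ∈ C \ A ∨ q ∈ A \ C) := by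
  have ha : a ∈ C \ A := swapTable'_offdiag A C e m1 h hne
  obtain ⟨p, rfl⟩ := exists_pos_of_mem_Y e m2 m3 m4 ha
  refine ⟨ha, ?_⟩
  rcases swapTable'_path_row_ne_zero e p h hne with ⟨p', -, rfl⟩ | ⟨i, -, rfl⟩
  · exact Or.inl (m1 p')
  · exact Or.inr (m2 i)

/-- **nobody's target**: a coordinate off the path and off the attachments has a zero column off the diagonal. -/
theorem swapTable'_col_zero {k j j' : ℕ} (A C : Finset α) (e : (Fin (k + 1) ⊕ Fin k) ⊕ (Fin j ⊕ Fin j') ≃ α)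
    (m1 : ∀ b, e (Sum.inl (Sum.inl b)) ∈ C \ A) (m2 : ∀ i, e (Sum.inl (Sum.inr i)) ∈ A \ C)
    (m3 : ∀ z, e (Sum.inr (Sum.inl z)) ∈ A ∩ C) (m4 : ∀ w, e (Sum.inr (Sum.inr w)) ∈ (A ∪ C)ᶜ)
    {a q : α} (hq₁ : q ∉ C \ A) (hq₂ : q ∉ A \ C) (hne : q ≠ a) : swapTable' e a q = 0 := by
  by_contra h
  rcases (swapTable'_target A C e m1 m2 m3 m4 h hne).2 with h' | h'
  · exact hq₁ h'
  · exact hq₂ h'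

/-- **the source of a path node**: an edge into the node at position `p` comes from the node at position `p + 1`. -/
theorem swapTable'_source_of_path {k j j' : ℕ} (A C : Finset α)
    (e : (Fin (k + 1) ⊕ Fin k) ⊕ (Fin j ⊕ Fin j') ≃ α)
    (m1 : ∀ b, e (Sum.inl (Sum.inl b)) ∈ C \ A) (m2 : ∀ i, e (Sum.inl (Sum.inr i)) ∈ A \ C)
    (m3 : ∀ z, e (Sum.inr (Sum.inl z)) ∈ A ∩ C) (m4 : ∀ w, e (Sum.inr (Sum.inr w)) ∈ (A ∪ C)ᶜ)
    (p : Fin (k + 1)) {a : α} (h : swapTable' e a (e (Sum.inl (Sum.inl p))) ≠ 0) (hne : a ≠ e (Sum.inl (Sum.inl p))) :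
    ∃ hp : (p : ℕ) + 1 < k + 1, a = e (Sum.inl (Sum.inl ⟨(p : ℕ) + 1, hp⟩)) := by
  have ha : a ∈ C \ A := swapTable'_offdiag A C e m1 h (Ne.symm hne)
  obtain ⟨p', rfl⟩ := exists_pos_of_mem_Y e m2 m3 m4 ha
  rw [swapTable'_path_path] at h
  have hpp : p ≠ p' := fun h' => hne (by rw [h'])
  rw [if_neg hpp] at h
  by_cases h1 : (p : ℕ) + 1 = p'
  · refine ⟨by rw [h1]; exact p'.isLt, ?_⟩
    congr 3; ext; exact h1.symm
  · rw [if_neg h1] at h; exact (h rfl).elim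

/-- **the source of an attachment**: an edge into the attachment `i` comes from the node at position `lvlX k i`. -/
theorem swapTable'_source_of_att {k j j' : ℕ} (A C : Finset α)
    (e : (Fin (k + 1) ⊕ Fin k) ⊕ (Fin j ⊕ Fin j') ≃ α)
    (m1 : ∀ b, e (Sum.inl (Sum.inl b)) ∈ C \ A) (m2 : ∀ i, e (Sum.inl (Sum.inr i)) ∈ A \ C)
    (m3 : ∀ z, e (Sum.inr (Sum.inl z)) ∈ A ∩ C) (m4 : ∀ w, e (Sum.inr (Sum.inr w)) ∈ (A ∪ C)ᶜ)
    (i : Fin k) {a : α} (h : swapTable' e a (e (Sum.inl (Sum.inr i))) ≠ 0) (hne : a ≠ e (Sum.inl (Sum.inr i))) :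
    ∃ hp : lvlX k i < k + 1, a = e (Sum.inl (Sum.inl ⟨lvlX k i, hp⟩)) := by
  have ha : a ∈ C \ A := swapTable'_offdiag A C e m1 h (Ne.symm hne)
  obtain ⟨p', rfl⟩ := exists_pos_of_mem_Y e m2 m3 m4 ha
  rw [swapTable'_path_att] at h
  by_cases h1 : lvlX k i = p'
  · refine ⟨by rw [h1]; exact p'.isLt, ?_⟩
    congr 3; ext; exact h1.symm
  · rw [if_neg h1] at h; exact (h rfl).elim

/-- **the top is a source**: no edge enters the node at position `k`. -/
theorem swapTable'_top_col {k j j' : ℕ} (A C : Finset α)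
    (e : (Fin (k + 1) ⊕ Fin k) ⊕ (Fin j ⊕ Fin j') ≃ α)
    (m1 : ∀ b, e (Sum.inl (Sum.inl b)) ∈ C \ A) (m2 : ∀ i, e (Sum.inl (Sum.inr i)) ∈ A \ C)
    (m3 : ∀ z, e (Sum.inr (Sum.inl z)) ∈ A ∩ C) (m4 : ∀ w, e (Sum.inr (Sum.inr w)) ∈ (A ∪ C)ᶜ)
    {a : α} (hne : a ≠ e (Sum.inl (Sum.inl (Fin.last k)))) : swapTable' e a (e (Sum.inl (Sum.inl (Fin.last k)))) = 0 := by
  by_contra h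
  obtain ⟨hp, -⟩ := swapTable'_source_of_path A C e m1 m2 m3 m4 (Fin.last k) h hne
  simp [Fin.val_last] at hp

omit [Fintype α] [DecidableEq α] in
/-- **out-neighbours of a path node**, positional form: the node below (if any) or an attachment of its own level. -/
theorem swapTable'_out_of_path {k j j' : ℕ} (e : (Fin (k + 1) ⊕ Fin k) ⊕ (Fin j ⊕ Fin j') ≃ α) (p : Fin (k + 1))
    {d : α} (hd : swapTable' e (e (Sum.inl (Sum.inl p))) d ≠ 0) (hne : d ≠ e (Sum.inl (Sum.inl p))) :
    (∃ hp : 1 ≤ (p : ℕ), d = e (Sum.inl (Sum.inl ⟨(p : ℕ) - 1, by omega⟩))) ∨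
      (∃ i : Fin k, lvlX k i = p ∧ d = e (Sum.inl (Sum.inr i))) := by
  rcases swapTable'_path_row_ne_zero e p hd hne with ⟨p', hp', rfl⟩ | ⟨i, hi, rfl⟩
  · left
    refine ⟨by omega, ?_⟩
    congr 3; ext; simp; omega
  · exact Or.inr ⟨i, hi, rfl⟩

/-- **edges of the two-parameter table, set form**: a nonzero off-diagonal entry of `I + ε₀N₁ + ε₁N₂` is an edge of one of the two
transports; its source lies on that path and its target on that path or among that swap's attachments. -/
theorem tab2_target {h : ℕ} {k₁ j₁ j₁' k₂ j₂ j₂' : ℕ} (A₁ C₁ A₂ C₂ : Finset (Fin h))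
    (e₁ : (Fin (k₁ + 1) ⊕ Fin k₁) ⊕ (Fin j₁ ⊕ Fin j₁') ≃ Fin h)
    (m1 : ∀ x, e₁ (Sum.inl (Sum.inl x)) ∈ C₁ \ A₁) (m2 : ∀ i, e₁ (Sum.inl (Sum.inr i)) ∈ A₁ \ C₁)
    (m3 : ∀ z, e₁ (Sum.inr (Sum.inl z)) ∈ A₁ ∩ C₁) (m4 : ∀ x, e₁ (Sum.inr (Sum.inr x)) ∈ (A₁ ∪ C₁)ᶜ)
    (e₂ : (Fin (k₂ + 1) ⊕ Fin k₂) ⊕ (Fin j₂ ⊕ Fin j₂') ≃ Fin h)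
    (n1 : ∀ x, e₂ (Sum.inl (Sum.inl x)) ∈ C₂ \ A₂) (n2 : ∀ i, e₂ (Sum.inl (Sum.inr i)) ∈ A₂ \ C₂)
    (n3 : ∀ z, e₂ (Sum.inr (Sum.inl z)) ∈ A₂ ∩ C₂) (n4 : ∀ x, e₂ (Sum.inr (Sum.inr x)) ∈ (A₂ ∪ C₂)ᶜ)
    (ε : Fin 2 → ℂ) {a q : Fin h} (hne : a ≠ q)
    (hw : tab2 (fun a q => swapTable' e₁ a q - if q = a then 1 else 0)
        (fun a q => swapTable' e₂ a q - if q = a then 1 else 0) ε a q ≠ 0) :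
    (a ∈ C₁ \ A₁ ∧ (q ∈ C₁ \ A₁ ∨ q ∈ A₁ \ C₁)) ∨ (a ∈ C₂ \ A₂ ∧ (q ∈ C₂ \ A₂ ∨ q ∈ A₂ \ C₂)) := by
  rcases (tab2_swapTable'_edges e₁ e₂ ε).2 a q hne hw with h' | h'
  · exact Or.inl (swapTable'_target A₁ C₁ e₁ m1 m2 m3 m4 h' (Ne.symm hne))
  · exact Or.inr (swapTable'_target A₂ C₂ e₂ n1 n2 n3 n4 h' (Ne.symm hne))

end SecondShell

end

end Summit.ValiantsHypothesis.ValiantsHypothesis.Theorems.BarrierLever.HiddenStates
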